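import Literature.NumberTheory.GaloisRepresentations.GL2F3Lift
import Literature.NumberTheory.SerreUniformity.SplitCartan
import HarnessLib

/-!
# Three facts about `GL₂(𝔽₃)`: every element has `g⁸ = 1` or `g⁶ = 1`; `g⁴ = 1 ∧ det g ≠ 1 ⟹ g² = 1`;
# the normaliser of the split Cartan subgroup has exponent `4` — certified by `decide` on the tree's
# explicit list of the `48` lifted matrices (`GL2F3Lift.M2.elems`)
# (cell `b2b-bsdres`, lane CLASS-CLOSURE, seat cc-typer-1; inputs of `GaloisImage/SmallImageNiveauDichotomy`)

HONEST FRAMING (cell `b2b-bsdres`, run/shared/lean/b2b/bsd-rank1-residual/, verbatim in every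
file): the goal of the cell is to DELETE the COMBINATION-SHAPED residual classes of the
Birch–Swinnerton-Dyer formula for ALL analytic-rank `≤ 1` elliptic curves over `ℚ` — "full BSD
formula for every rank `≤ 1` curve in class `C`" assembled STRICTLY from published theorems — so
that the rank-`≤ 1` remainder becomes exactly the CONSTRUCTION-SHAPED classes, which are TYPED
(missing-input `Prop`s), NOT attempted. This is not "finishing BSD". THEOREMS ONLY: finite group
theory of `GL₂(𝔽₃)` (element orders `1, 2, 3, 4, 6, 8`); no definition, no named fact, nothing
booked.

## Method
No `Fintype` enumeration of `GL (Fin 2) (ZMod 3)` is kernel-computable, so the three facts are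
checked by `decide` on the tree's explicit, decidable model of `GL₂(𝔽₃)`: the list `M2.elems` of
`48` matrices over `ℤ[√-2]` of `Literature/…/GL2F3Lift.lean` (Gelbart's lift `Ψ̃`,
`exists_lift_eq_toMat : ∃ x ∈ M2.elems, lift g = x.toMat`, `lift` multiplicative, reduction mod
`𝔭 = (1 + √-2)` the identity: `map_redHom_lift`), transported back to `GL₂(𝔽₃)` by reduction.

* `GL2F3Cyc.pow_eight_eq_one_or_pow_six_eq_one` — `g⁸ = 1 ∨ g⁶ = 1` for every `g ∈ GL₂(𝔽₃)`.
* `GL2F3Cyc.sq_eq_one_of_pow_four_eq_one_of_det_ne_one` — `g⁴ = 1`, `det g ≠ 1 ⟹ g² = 1`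
  (no element of order `4` has determinant `−1`).
* `GL2F3Cyc.pow_four_eq_one_of_mem_splitCartanNormalizer_three` — `M ∈ splitCartanNormalizer 3`
  (invertible, diagonal or antidiagonal) `⟹ M⁴ = 1`.
* `…_of_injective` forms through an injective `φ : G →* GL₂(𝔽₃)` (a frame of `Aut(E[3])`).

References: J.-P. Serre, Invent. Math. 15 (1972) §2 (subgroups of `GL₂(𝔽_p)`) [Serre1972];
S. Gelbart in Cornell–Silverman–Stevens (1997) §1.4 Step 1 (the lift) [Gelbart1997].
-/

namespace Summit.BirchSwinnertonDyer.Rank1Residual.GaloisImage.GL2F3Cyc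

open Literature.NumberTheory.GaloisRepresentations.GL2F3Lift
open Literature.NumberTheory.GaloisRepresentations.GL2F3Lift.M2 (mul one toMat elems)

/-! ### The three certificates on `M2.elems` (kernel `decide`) -/

/-- Certificate A on the `48` lifted matrices: `x⁸ = 1` or `x⁶ = 1` (as words in `M2.mul`). [folklore] -/
theorem certA : ∀ x ∈ elems,
    mul (mul (mul x x) (mul x x)) (mul (mul x x) (mul x x)) = one ∨
      mul (mul (mul x x) (mul x x)) (mul x x) = one := by
  decide

/-- Certificate B: `det x = −1 ∧ x⁴ = 1 ⟹ x² = 1` on the lifted matrices. [folklore] -/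
theorem certB : ∀ x ∈ elems, M2.det x = -1 →
    mul (mul x x) (mul x x) = one → mul x x = one := by
  decide

/-- Certificate C: a lifted matrix which is diagonal or antidiagonal mod `𝔭` has `x⁴ = 1`. [folklore] -/
theorem certC : ∀ x ∈ elems,
    ((M2.red x.b = 0 ∧ M2.red x.c = 0) ∨ (M2.red x.a = 0 ∧ M2.red x.d = 0)) →
      mul (mul x x) (mul x x) = one := by
  decide

/-! ### Transport to `GL₂(𝔽₃)` -/

/-- `lift (gⁿ) = (lift g)ⁿ`. [folklore] -/
theorem lift_pow (g : GL (Fin 2) (ZMod 3)) (n : ℕ) : lift (g ^ n) = lift g ^ n := by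
  induction n with
  | zero => rw [pow_zero, pow_zero, lift_one]
  | succ n ih => rw [pow_succ, pow_succ, lift_mul, ih]

/-- `lift` is injective (reduction mod `𝔭` is a left inverse). [folklore] -/
theorem eq_of_lift_eq {g h : GL (Fin 2) (ZMod 3)} (hgh : lift g = lift h) : g = h := by
  apply Units.ext
  rw [← map_redHom_lift g, ← map_redHom_lift h, hgh]

/-- `gⁿ = 1` as soon as `lift (gⁿ) = 1`. [folklore] -/
theorem pow_eq_one_of_lift_pow_eq_one {g : GL (Fin 2) (ZMod 3)} {n : ℕ} (h : lift g ^ n = 1) :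
    g ^ n = 1 :=
  eq_of_lift_eq (by rw [lift_pow, h, lift_one])

/-- **Every `g ∈ GL₂(𝔽₃)` has `g⁸ = 1` or `g⁶ = 1`** (the element orders of `GL₂(𝔽₃)` are
`1, 2, 3, 4, 6, 8`). [cite: Serre1972, §2] -/
theorem pow_eight_eq_one_or_pow_six_eq_one (g : GL (Fin 2) (ZMod 3)) : g ^ 8 = 1 ∨ g ^ 6 = 1 := by
  obtain ⟨x, hx, hgx⟩ := exists_lift_eq_toMat g
  have h2 : lift g ^ 2 = (mul x x).toMat := by rw [sq, hgx, M2.toMat_mul]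
  have h4 : lift g ^ 4 = (mul (mul x x) (mul x x)).toMat := by
    rw [show (4 : ℕ) = 2 + 2 from rfl, pow_add, h2, ← M2.toMat_mul]
  rcases certA x hx with h | h
  · left
    apply pow_eq_one_of_lift_pow_eq_one
    rw [show (8 : ℕ) = 4 + 4 from rfl, pow_add, h4, ← M2.toMat_mul, h, M2.toMat_one]
  · right
    apply pow_eq_one_of_lift_pow_eq_one
    rw [show (6 : ℕ) = 4 + 2 from rfl, pow_add, h4, h2, ← M2.toMat_mul, h, M2.toMat_one]

/-- **`g⁴ = 1` and `det g ≠ 1 ⟹ g² = 1` in `GL₂(𝔽₃)`** (the elements of order `4` have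
determinant `1`). [cite: Serre1972, §2] -/
theorem sq_eq_one_of_pow_four_eq_one_of_det_ne_one (g : GL (Fin 2) (ZMod 3)) (h4 : g ^ 4 = 1)
    (hdet : Matrix.GeneralLinearGroup.det g ≠ 1) : g ^ 2 = 1 := by
  obtain ⟨x, hx, hgx⟩ := exists_lift_eq_toMat g
  -- `det g = −1` in `𝔽₃`, hence `det (lift g) = −1`
  have hval : ((Matrix.GeneralLinearGroup.det g : (ZMod 3)ˣ) : ZMod 3) ≠ 1 := fun h ↦
    hdet (Units.val_eq_one.mp h)
  have hne0 : ((Matrix.GeneralLinearGroup.det g : (ZMod 3)ˣ) : ZMod 3) ≠ 0 :=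
    (Matrix.GeneralLinearGroup.det g).ne_zero
  have htwo : ∀ y : ZMod 3, y ≠ 0 → y ≠ 1 → y = -1 := by decide
  have hdetm : (g : Matrix (Fin 2) (Fin 2) (ZMod 3)).det = -1 := by
    rw [← Matrix.GeneralLinearGroup.val_det_apply]; exact htwo _ hne0 hval
  have hdetx : M2.det x = -1 := by
    rw [← M2.det_toMat, ← hgx]; exact det_lift_of_det_eq_neg_one g hdetm
  have h2 : lift g ^ 2 = (mul x x).toMat := by rw [sq, hgx, M2.toMat_mul]
  have h4' : (mul (mul x x) (mul x x)).toMat = one.toMat := by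
    rw [M2.toMat_mul, ← h2, ← pow_add, show (2 + 2 : ℕ) = 4 from rfl, ← lift_pow, h4, lift_one,
      M2.toMat_one]
  have hinj : ∀ y z : Literature.NumberTheory.GaloisRepresentations.GL2F3Lift.M2,
      y.toMat = z.toMat → y = z := by
    intro y z h
    have ha := congr_fun (congr_fun h 0) 0
    have hb := congr_fun (congr_fun h 0) 1
    have hc := congr_fun (congr_fun h 1) 0
    have hd := congr_fun (congr_fun h 1) 1
    simp only [M2.toMat, Matrix.of_apply, Matrix.cons_val', Matrix.cons_val_zero, Matrix.cons_val_one,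
      Matrix.cons_val_fin_one] at ha hb hc hd
    cases y; cases z; simp_all
  have hsq := certB x hx hdetx (hinj _ _ h4')
  apply pow_eq_one_of_lift_pow_eq_one
  rw [h2, hsq, M2.toMat_one]

/-- **The normaliser of the (diagonal) split Cartan subgroup of `GL₂(𝔽₃)` has exponent `4`**:
`M ∈ splitCartanNormalizer 3 ⟹ M⁴ = 1`. [cite: BiluParentRebolledo2013, §1 (after Cor. 1.2)] -/
theorem pow_four_eq_one_of_mem_splitCartanNormalizer_three {M : Matrix (Fin 2) (Fin 2) (ZMod 3)}
    (hM : M ∈ Literature.NumberTheory.SerreUniformity.splitCartanNormalizer 3) : M ^ 4 = 1 := by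
  obtain ⟨hdet, hshape⟩ := hM
  set g : GL (Fin 2) (ZMod 3) := Matrix.GeneralLinearGroup.mkOfDetNeZero M hdet with hg
  have hgM : (g : Matrix (Fin 2) (Fin 2) (ZMod 3)) = M := rfl
  obtain ⟨x, hx, hgx⟩ := exists_lift_eq_toMat g
  -- the shape of `M = (lift g) mod 𝔭` read on `x`
  have hred : M = !![M2.red x.a, M2.red x.b; M2.red x.c, M2.red x.d] := by
    rw [← hgM, ← map_redHom_lift g, hgx, map_toMat_redHom]
  have ha : M 0 0 = M2.red x.a := by rw [hred]; rfl
  have hb : M 0 1 = M2.red x.b := by rw [hred]; rfl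
  have hc : M 1 0 = M2.red x.c := by rw [hred]; rfl
  have hd : M 1 1 = M2.red x.d := by rw [hred]; rfl
  have hshape' : (M2.red x.b = 0 ∧ M2.red x.c = 0) ∨ (M2.red x.a = 0 ∧ M2.red x.d = 0) := by
    rw [← ha, ← hb, ← hc, ← hd]; exact hshape
  have h4x := certC x hx hshape'
  have h4 : g ^ 4 = 1 := by
    apply pow_eq_one_of_lift_pow_eq_one
    rw [show (4 : ℕ) = 2 + 2 from rfl, pow_add, sq, hgx, ← M2.toMat_mul, ← M2.toMat_mul, h4x,
      M2.toMat_one]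
  have := congrArg (fun u : GL (Fin 2) (ZMod 3) ↦ (u : Matrix (Fin 2) (Fin 2) (ZMod 3))) h4
  simpa only [Units.val_pow_eq_pow_val, hgM, Units.val_one] using this

/-- `g⁸ = 1 ∨ g⁶ = 1` in any group with an injective homomorphism to `GL₂(𝔽₃)` (e.g. `Aut(E[3])`
through a frame). [folklore] -/
theorem pow_eight_eq_one_or_pow_six_eq_one_of_injective {G : Type*} [Group G]
    (φ : G →* GL (Fin 2) (ZMod 3)) (hφ : Function.Injective φ) (g : G) : g ^ 8 = 1 ∨ g ^ 6 = 1 := by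
  rcases pow_eight_eq_one_or_pow_six_eq_one (φ g) with h | h
  · exact Or.inl (hφ (by rw [map_pow, h, map_one]))
  · exact Or.inr (hφ (by rw [map_pow, h, map_one]))

/-- `g⁴ = 1 ∧ det φ(g) ≠ 1 ⟹ g² = 1` through an injective `φ : G →* GL₂(𝔽₃)`. [folklore] -/
theorem sq_eq_one_of_pow_four_eq_one_of_det_ne_one_of_injective {G : Type*} [Group G]
    (φ : G →* GL (Fin 2) (ZMod 3)) (hφ : Function.Injective φ) (g : G) (h4 : g ^ 4 = 1)
    (hdet : Matrix.GeneralLinearGroup.det (φ g) ≠ 1) : g ^ 2 = 1 := by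
  have h4' : φ g ^ 4 = 1 := by rw [← map_pow, h4, map_one]
  exact hφ (by rw [map_pow, sq_eq_one_of_pow_four_eq_one_of_det_ne_one (φ g) h4' hdet, map_one])

end Summit.BirchSwinnertonDyer.Rank1Residual.GaloisImage.GL2F3Cyc
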